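import Literature.ModelTheory.PseudofiniteFields.CountingDimensionDefinable
import Literature.ModelTheory.PseudofiniteFields.NonsingularZerosFinite
import Literature.ModelTheory.PseudofiniteFields.GenericEtaleInterior
import Literature.ModelTheory.PseudofiniteFields.NoLonelyTranslates
import HarnessLib

/-!
# The dimension of standard smooth loci and of their étale-open subsets (pseudo-finite fields)

Topic `Literature/ModelTheory/PseudofiniteFields`.  For the rendering of the étale-open
topology on `K^m` of `EtaleOpenTopology.lean` (standard étale data, standard smooth data
`S = (g_1..g_c ; h ; cols)` with locus `{g = 0, h·Δ ≠ 0}`) and the fibre-counting dimension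
`DimAtLeast` of `CountingDimension.lean`, over a PSEUDO-FINITE field `K`:

* `SmoothDatum.not_dimAtLeast_locus` — a standard smooth locus of codimension `c` has
  dimension `< m − c + 1` (conditional on the CDM Main Theorem, through the permutation
  invariance of the dimension of definable sets);
* `SmoothDatum.dimAtLeast_of_isEtaleOpenIn` — a definable set containing a NONEMPTY étale-open
  subset of a standard smooth locus of codimension `c` has dimension `≥ m − c` (conditional on
  CDM and on [JohnsonTranWalsbergYe2024, Thm 7.1] for pseudo-finite fields: no point of a
  positive-dimensional locus is étale-isolated).

Both are inductions on `m − c`, slicing the locus by the coordinate hyperplanes `x_j = b` of a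
free coordinate `j` (moved to position `0` by a coordinate permutation, `SmoothDatum.perm`,
`SmoothDatum.sliceAt`): the slices are standard smooth loci of codimension `c + 1`, a locus of
codimension `m` is finite (`SmoothDatum.locus_finite_of_eq`, from `finite_nonsingular_zeros`),
a nonempty étale-open subset of a positive-dimensional locus is infinite
(`infinite_of_isEtaleOpenIn`, Thm 7.1 plus a principal open separating finitely many points),
and its projection to a free coordinate is infinite (`infinite_image_apply_zero`).  This is the
elementary dimension theory that [ChatzidakisVanDenDriesMacintyre1992, §3] obtain from
Lang–Weil; here it rests on the two étale-open facts instead.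

## References

* [JohnsonTranWalsbergYe2024] W. Johnson, C.-M. Tran, E. Walsberg, J. Ye, The étale-open topology
  and the stable fields conjecture, J. Eur. Math. Soc. 26 (2024), Thm 7.1, Thm A.
* [WalsbergYe2023] E. Walsberg, J. Ye, Éz fields, J. Algebra 614 (2023), Thm C (1).
* [ChatzidakisVanDenDriesMacintyre1992] Z. Chatzidakis, L. van den Dries, A. Macintyre,
  Definable sets over finite fields, J. reine angew. Math. 427 (1992) 107–135, §3.
-/

namespace Literature.ModelTheory.PseudofiniteFields

open MvPolynomial FirstOrder FirstOrder.Language FirstOrder.Ring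

/-! ### Polynomially defined sets are definable with the coefficients as parameters -/

section PolyLocus

variable {K : Type} [Field K] {m : ℕ}

/-- Coefficient extraction: a polynomial of total degree `≤ N` is a box polynomial of
multi-degree `≤ N` with the same evaluations. [folklore] -/
theorem exists_box_eq_eval (D : MvPolynomial (Fin m) K) {N : ℕ} (hN : D.totalDegree ≤ N) :
    ∃ d : (Fin m → Fin (N + 1)) → K, ∀ w : Fin m → K,
      ∑ β : Fin m → Fin (N + 1), d β * ∏ l : Fin m, w l ^ ((β l : ℕ)) = eval w D := by
  by_cases hD : D = 0
  · refine ⟨0, fun w => ?_⟩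
    simp [hD]
  · obtain ⟨d, -, hd⟩ := exists_box_of_ne_zero D hD hN
    exact ⟨d, hd⟩

/-- **A set cut out by finitely many polynomial equations and inequations is definable**, by
one ring formula with the coefficients as parameters. [folklore] -/
theorem exists_defSet_eq_polyLocus {ι κ : Type} [Finite ι] [Finite κ]
    (P : ι → MvPolynomial (Fin m) K) (Q : κ → MvPolynomial (Fin m) K) [CompatibleRing K] :
    ∃ (γ : Type) (_ : Finite γ) (φ : Language.ring.Formula (Fin m ⊕ γ)) (v : γ → K),
      defSet φ K v = {x | (∀ i, eval x (P i) = 0) ∧ ∀ k, eval x (Q k) ≠ 0} := by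
  classical
  haveI := Fintype.ofFinite ι
  haveI := Fintype.ofFinite κ
  -- a common degree bound and the coefficient boxes
  set N : ℕ := (Finset.univ.sup fun i => (P i).totalDegree) ⊔
    (Finset.univ.sup fun k => (Q k).totalDegree) with hN
  have hP : ∀ i, (P i).totalDegree ≤ N := fun i =>
    (Finset.le_sup (f := fun i => (P i).totalDegree) (Finset.mem_univ i)).trans le_sup_left
  have hQ : ∀ k, (Q k).totalDegree ≤ N := fun k =>
    (Finset.le_sup (f := fun k => (Q k).totalDegree) (Finset.mem_univ k)).trans le_sup_right
  choose dP hdP using fun i => exists_box_eq_eval (P i) (hP i)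
  choose dQ hdQ using fun k => exists_box_eq_eval (Q k) (hQ k)
  -- the formula, parameters `(ι ⊕ κ) × box`
  obtain ⟨φ, hφ⟩ := definable_and
    (definable_iInf fun i => definable_boxSum_eq_zero m N
      (fun β => (Sum.inr (Sum.inl i, β) : Fin m ⊕ (ι ⊕ κ) × (Fin m → Fin (N + 1)))) Sum.inl)
    (definable_iInf fun k => definable_boxSum_ne_zero m N
      (fun β => (Sum.inr (Sum.inr k, β) : Fin m ⊕ (ι ⊕ κ) × (Fin m → Fin (N + 1)))) Sum.inl)
  refine ⟨(ι ⊕ κ) × (Fin m → Fin (N + 1)), inferInstance, φ,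
    fun q => Sum.elim (fun i => dP i q.2) (fun k => dQ k q.2) q.1, Set.ext fun x => ?_⟩
  rw [mem_defSet, hφ]
  simp only [Sum.elim_inl, Sum.elim_inr, hdP, hdQ, Set.mem_setOf_eq]

/-- **A standard smooth locus is definable** (coefficients as parameters). [folklore] -/
theorem SmoothDatum.exists_defSet_eq_locus [CompatibleRing K] {c : ℕ} (S : SmoothDatum K m c) :
    ∃ (γ : Type) (_ : Finite γ) (φ : Language.ring.Formula (Fin m ⊕ γ)) (v : γ → K),
      defSet φ K v = S.locus := by
  obtain ⟨γ, hγ, φ, v, h⟩ := exists_defSet_eq_polyLocus S.g ![S.h, S.minor]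
  refine ⟨γ, hγ, φ, v, ?_⟩
  rw [h]
  ext x
  simp only [Set.mem_setOf_eq, SmoothDatum.mem_locus_iff, Fin.forall_fin_two, Matrix.cons_val_zero,
    Matrix.cons_val_one]

/-- **Slices of a definable family are a definable family** (with the slice value as an extra
parameter): `ψ(K; v, b) = {x ∈ φ(K; v) | x 0 = b}`. [folklore] -/
theorem exists_formula_slice {γ : Type} {n : ℕ} (φ : Language.ring.Formula (Fin (n + 1) ⊕ γ)) :
    ∃ ψ : Language.ring.Formula (Fin (n + 1) ⊕ (γ ⊕ Unit)), ∀ (K : Type) [Field K]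
      [CompatibleRing K] (v : γ → K) (b : K),
      defSet ψ K (Sum.elim v fun _ => b) = slice (defSet φ K v) b := by
  obtain ⟨ψ, hψ⟩ := definable_and
    (definable_realize₂ φ (Sum.inl : Fin (n + 1) → Fin (n + 1) ⊕ (γ ⊕ Unit))
      fun g => Sum.inr (Sum.inl g))
    (definable_termEq (Term.var (Sum.inl 0 : Fin (n + 1) ⊕ (γ ⊕ Unit)))
      (Term.var (Sum.inr (Sum.inr ()))))
  refine ⟨ψ, fun K _ _ v b => Set.ext fun x => ?_⟩
  rw [mem_defSet, hψ, mem_slice, mem_defSet]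
  simp only [Sum.elim_inl, Sum.elim_inr, Term.realize_var]

end PolyLocus

/-! ### Coordinate permutations and slices of standard data -/

section Perm

variable {K : Type*} [CommRing K] {m r c : ℕ}

/-- **Étale images are stable under coordinate permutations**: `{x | x ∘ σ ∈ D.image}` is the
image of the datum with renamed set variables. [folklore] -/
theorem EtaleDatum.exists_image_eq_comp_perm (D : EtaleDatum K m r) (σ : Equiv.Perm (Fin m)) :
    ∃ D' : EtaleDatum K m r, D'.image = {x | x ∘ σ ∈ D.image} := by
  have hinj : Function.Injective (Sum.map σ id : Fin m ⊕ Fin r → Fin m ⊕ Fin r) :=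
    Sum.map_injective.2 ⟨σ.injective, Function.injective_id⟩
  refine ⟨⟨fun i => rename (Sum.map σ id) (D.G i), rename (Sum.map σ id) D.H⟩, Set.ext fun x => ?_⟩
  have hJ : EtaleDatum.jacobianDet ⟨fun i => rename (Sum.map σ id) (D.G i), rename (Sum.map σ id) D.H⟩ =
      rename (Sum.map σ id) D.jacobianDet := by
    unfold EtaleDatum.jacobianDet
    rw [AlgHom.map_det]
    congr 1
    refine Matrix.ext fun i j => ?_
    simp only [Matrix.of_apply, AlgHom.mapMatrix_apply, Matrix.map_apply]
    exact pderiv_rename hinj (Sum.inr j) (D.G i)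
  have hcomp : ∀ t : Fin r → K, (Sum.elim x t ∘ Sum.map σ id) = Sum.elim (x ∘ σ) t :=
    fun t => funext fun i => by cases i <;> rfl
  simp only [EtaleDatum.mem_image_iff, hJ, eval_rename, hcomp, Set.mem_setOf_eq]

/-- Étale-openness is stable under coordinate permutations. [folklore] -/
theorem IsEtaleOpenIn.comp_perm {V S : Set (Fin m → K)} (h : IsEtaleOpenIn K V S)
    (σ : Equiv.Perm (Fin m)) : IsEtaleOpenIn K {x | x ∘ σ ∈ V} {x | x ∘ σ ∈ S} := by
  refine ⟨fun x hx => h.1 hx, fun p hp => ?_⟩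
  obtain ⟨r, D, hpD, hDV⟩ := h.2 (p ∘ σ) hp
  obtain ⟨D', hD'⟩ := D.exists_image_eq_comp_perm σ
  refine ⟨r, D', by rw [hD']; exact hpD, fun x hx => ?_⟩
  rw [hD'] at hx
  exact hDV ⟨hx.1, hx.2⟩

/-- Étale-openness restricts to coordinate hyperplanes: if `S` is étale-open in `V`, then
`{x ∈ S | x j = b}` is étale-open in `{x ∈ V | x j = b}`. [folklore] -/
theorem IsEtaleOpenIn.sep_apply_eq {V S : Set (Fin m → K)} (h : IsEtaleOpenIn K V S) (j : Fin m)
    (b : K) : IsEtaleOpenIn K {x | x ∈ V ∧ x j = b} {x | x ∈ S ∧ x j = b} := by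
  refine ⟨fun x hx => ⟨h.1 hx.1, hx.2⟩, fun p hp => ?_⟩
  obtain ⟨r, D, hpD, hDV⟩ := h.2 p hp.1
  exact ⟨r, D, hpD, fun x hx => ⟨hDV ⟨hx.1, hx.2.1⟩, hx.2.2⟩⟩

/-- Étale-openness is stable under intersection with a basic étale-open set (over a domain).
[folklore] -/
theorem IsEtaleOpenIn.inter_image [IsDomain K] {V S : Set (Fin m → K)} (h : IsEtaleOpenIn K V S)
    (O : EtaleDatum K m r) : IsEtaleOpenIn K V (S ∩ O.image) := by
  refine ⟨fun x hx => h.1 hx.1, fun p hp => ?_⟩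
  obtain ⟨r₁, D, hpD, hDV⟩ := h.2 p hp.1
  obtain ⟨D', hD'⟩ := D.exists_image_eq_inter O
  refine ⟨_, D', by rw [hD']; exact ⟨hpD, hp.2⟩, fun x hx => ?_⟩
  rw [hD'] at hx
  exact ⟨hDV ⟨hx.1.1, hx.2⟩, hx.1.2⟩

namespace SmoothDatum

/-- **The permuted standard smooth datum**: rename the coordinates by `σ`; its locus is
`{x | x ∘ σ ∈ S.locus}` and its Jacobian columns are `σ ∘ cols`. [folklore] -/
noncomputable def perm (S : SmoothDatum K m c) (σ : Equiv.Perm (Fin m)) : SmoothDatum K m c :=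
  ⟨fun i => rename σ (S.g i), rename σ S.h, S.cols.trans σ.toEmbedding⟩

/-- The columns of the permuted datum. [folklore] -/
@[simp] theorem perm_cols (S : SmoothDatum K m c) (σ : Equiv.Perm (Fin m)) (j : Fin c) :
    (S.perm σ).cols j = σ (S.cols j) := rfl

/-- The equations of the permuted datum. [folklore] -/
@[simp] theorem perm_g (S : SmoothDatum K m c) (σ : Equiv.Perm (Fin m)) (i : Fin c) :
    (S.perm σ).g i = rename σ (S.g i) := rfl

/-- The localisation of the permuted datum. [folklore] -/
@[simp] theorem perm_h (S : SmoothDatum K m c) (σ : Equiv.Perm (Fin m)) :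
    (S.perm σ).h = rename σ S.h := rfl

/-- The Jacobian minor of the permuted datum is the renamed minor. [folklore] -/
theorem minor_perm (S : SmoothDatum K m c) (σ : Equiv.Perm (Fin m)) :
    (S.perm σ).minor = rename σ S.minor := by
  unfold SmoothDatum.minor
  rw [AlgHom.map_det]
  congr 1
  refine Matrix.ext fun i j => ?_
  simp only [Matrix.of_apply, AlgHom.mapMatrix_apply, Matrix.map_apply, perm_cols, perm_g]
  exact pderiv_rename σ.injective (S.cols j) (S.g i)

/-- The locus of the permuted datum. [folklore] -/
theorem locus_perm (S : SmoothDatum K m c) (σ : Equiv.Perm (Fin m)) :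
    (S.perm σ).locus = {x | x ∘ σ ∈ S.locus} := by
  ext x
  simp only [SmoothDatum.mem_locus_iff, minor_perm, perm_g, perm_h, Set.mem_setOf_eq, eval_rename]

/-- **The slice datum**: add the equation `X_j − b` for a FREE coordinate `j` (not a Jacobian
column) as equation `0` and `j` as column `0`; codimension `c + 1`. [folklore] -/
noncomputable def sliceAt (S : SmoothDatum K m c) (j : Fin m) (hj : j ∉ Set.range S.cols) (b : K) :
    SmoothDatum K m (c + 1) :=
  ⟨Fin.cons (X j - C b) S.g, S.h, ⟨Fin.cons j S.cols, Fin.cons_injective_iff.2 ⟨hj, S.cols.injective⟩⟩⟩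

/-- Equation `0` of the slice datum. [folklore] -/
@[simp] theorem sliceAt_g_zero (S : SmoothDatum K m c) (j : Fin m) (hj : j ∉ Set.range S.cols) (b : K) :
    (S.sliceAt j hj b).g 0 = X j - C b := rfl

/-- The other equations of the slice datum. [folklore] -/
@[simp] theorem sliceAt_g_succ (S : SmoothDatum K m c) (j : Fin m) (hj : j ∉ Set.range S.cols) (b : K)
    (k : Fin c) : (S.sliceAt j hj b).g k.succ = S.g k :=
  Fin.cons_succ (α := fun _ : Fin (c + 1) => MvPolynomial (Fin m) K) (X j - C b) S.g k

/-- Column `0` of the slice datum. [folklore] -/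
@[simp] theorem sliceAt_cols_zero (S : SmoothDatum K m c) (j : Fin m) (hj : j ∉ Set.range S.cols) (b : K) :
    (S.sliceAt j hj b).cols 0 = j := rfl

/-- The other columns of the slice datum. [folklore] -/
@[simp] theorem sliceAt_cols_succ (S : SmoothDatum K m c) (j : Fin m) (hj : j ∉ Set.range S.cols) (b : K)
    (k : Fin c) : (S.sliceAt j hj b).cols k.succ = S.cols k :=
  Fin.cons_succ (α := fun _ : Fin (c + 1) => Fin m) j S.cols k

/-- The localisation of the slice datum. [folklore] -/
@[simp] theorem sliceAt_h (S : SmoothDatum K m c) (j : Fin m) (hj : j ∉ Set.range S.cols) (b : K) :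
    (S.sliceAt j hj b).h = S.h := rfl

/-- The columns of the slice datum: `j`, then the old columns. [folklore] -/
theorem range_sliceAt_cols (S : SmoothDatum K m c) (j : Fin m) (hj : j ∉ Set.range S.cols) (b : K) :
    Set.range (S.sliceAt j hj b).cols = insert j (Set.range S.cols) := by
  show Set.range (Fin.cons j S.cols : Fin (c + 1) → Fin m) = _
  exact Fin.range_cons _ _

/-- **The Jacobian minor of the slice datum is the old minor** (the new row is the unit vector
at the new column). [folklore] -/
theorem minor_sliceAt [Nontrivial K] (S : SmoothDatum K m c) (j : Fin m) (hj : j ∉ Set.range S.cols) (b : K) :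
    (S.sliceAt j hj b).minor = S.minor := by
  classical
  unfold SmoothDatum.minor
  rw [Matrix.det_succ_row_zero, Finset.sum_eq_single 0]
  · have h00 : (Matrix.of fun i j' => pderiv ((S.sliceAt j hj b).cols j') ((S.sliceAt j hj b).g i)) 0 0 = 1 := by
      rw [Matrix.of_apply, sliceAt_cols_zero, sliceAt_g_zero, map_sub, pderiv_C, sub_zero, pderiv_X_self]
    rw [h00, Fin.val_zero, pow_zero, one_mul, one_mul, Fin.succAbove_zero]
    congr 1
  · intro j' _ hj'
    have h0j : (Matrix.of fun i j' => pderiv ((S.sliceAt j hj b).cols j') ((S.sliceAt j hj b).g i)) 0 j' = 0 := by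
      obtain ⟨k, rfl⟩ := Fin.exists_succ_eq.2 hj'
      rw [Matrix.of_apply, sliceAt_cols_succ, sliceAt_g_zero, map_sub, pderiv_C, sub_zero,
        pderiv_X_of_ne]
      exact fun h => hj ⟨k, h.symm⟩
    rw [h0j, mul_zero, zero_mul]
  · intro h; exact absurd (Finset.mem_univ 0) h

/-- **The locus of the slice datum is the slice of the locus.** [folklore] -/
theorem locus_sliceAt [Nontrivial K] (S : SmoothDatum K m c) (j : Fin m) (hj : j ∉ Set.range S.cols) (b : K) :
    (S.sliceAt j hj b).locus = {x | x ∈ S.locus ∧ x j = b} := by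
  ext x
  simp only [SmoothDatum.mem_locus_iff, minor_sliceAt, Set.mem_setOf_eq]
  have hg : (∀ i, eval x ((S.sliceAt j hj b).g i) = 0) ↔ x j = b ∧ ∀ i, eval x (S.g i) = 0 := by
    rw [Fin.forall_fin_succ, sliceAt_g_zero]
    simp only [sliceAt_g_succ, map_sub, eval_X, eval_C, sub_eq_zero]
  rw [hg, sliceAt_h]
  tauto

/-- **A standard smooth datum of positive dimension has a free coordinate** (not a Jacobian
column). [folklore] -/
theorem exists_not_mem_range_cols (S : SmoothDatum K m c) (h : c < m) :
    ∃ j : Fin m, j ∉ Set.range S.cols := by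
  by_contra hall
  push Not at hall
  have := Fintype.card_le_of_surjective S.cols fun j => hall j
  simp only [Fintype.card_fin] at this
  omega

/-- A standard smooth datum of dimension `≥ 2` has a free coordinate other than a given one.
[folklore] -/
theorem exists_not_mem_range_cols_ne (S : SmoothDatum K m c) (h : c + 1 < m) (i₀ : Fin m) :
    ∃ j : Fin m, j ∉ Set.range S.cols ∧ j ≠ i₀ := by
  by_contra hall
  push Not at hall
  have hsurj : Function.Surjective (Fin.cons i₀ (S.cols : Fin c → Fin m) : Fin (c + 1) → Fin m) := by
    intro j
    by_cases hj : j ∈ Set.range S.cols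
    · obtain ⟨k, rfl⟩ := hj
      exact ⟨k.succ, Fin.cons_succ _ _ _⟩
    · exact ⟨0, by rw [Fin.cons_zero]; exact (hall j hj).symm⟩
  have := Fintype.card_le_of_surjective _ hsurj
  simp only [Fintype.card_fin] at this
  omega

end SmoothDatum

end Perm

/-! ### Finiteness of loci of codimension `m`; infinitude of étale-open sets -/

section Finite

variable {K : Type*} [Field K] {m c : ℕ}

/-- **A standard smooth locus of codimension `m` in `K^m` is finite**: it is a set of
nonsingular zeros of a square system (reorder the variables by the Jacobian columns).
[folklore] (from `finite_nonsingular_zeros`) -/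
theorem SmoothDatum.locus_finite_of_eq (S : SmoothDatum K m c) (h : m = c) : S.locus.Finite := by
  have hbij : Function.Bijective S.cols :=
    (Fintype.bijective_iff_injective_and_card S.cols).2 ⟨S.cols.injective, by simp [h]⟩
  set e : Fin c ≃ Fin m := Equiv.ofBijective S.cols hbij with he
  have he' : ∀ j, e j = S.cols j := fun j => rfl
  have key := finite_nonsingular_zeros (fun i => rename e.symm (S.g i))
  refine (key.image fun z => z ∘ e.symm).subset fun x hx => ?_
  have hxe : ∀ p : MvPolynomial (Fin m) K, eval (x ∘ e) (rename e.symm p) = eval x p := fun p => by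
    have hx : (x ∘ e) ∘ e.symm = x := funext fun i => by simp
    rw [eval_rename, hx]
  refine ⟨x ∘ e, ⟨fun i => by rw [hxe]; exact hx.1 i, ?_⟩, funext fun i => by simp⟩
  have hmat : (Matrix.of fun i j : Fin c => pderiv j (rename e.symm (S.g i))) =
      (rename e.symm).mapMatrix (Matrix.of fun i j : Fin c => pderiv (S.cols j) (S.g i)) := by
    ext i j
    simp only [Matrix.of_apply, AlgHom.mapMatrix_apply, Matrix.map_apply]
    have := pderiv_rename e.symm.injective (e j) (S.g i)
    rw [Equiv.symm_apply_apply] at this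
    rw [this, he']
  show eval (x ∘ e) (Matrix.of fun i j : Fin c => pderiv j (rename e.symm (S.g i))).det ≠ 0
  rw [hmat, ← AlgHom.map_det, hxe]
  exact hx.2.2

/-- **A principal open set separating a point from finitely many others**: for finite `Z` and a
point `p` there is a basic étale-open neighbourhood of `p` containing no point of `Z` other than
`p` (the non-vanishing set of a product of linear forms). [folklore] -/
theorem exists_etaleDatum_isolating {Z : Set (Fin m → K)} (hZ : Z.Finite) (p : Fin m → K) :
    ∃ D : EtaleDatum K m 1, p ∈ D.image ∧ ∀ z ∈ Z, z ∈ D.image → z = p := by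
  classical
  -- for each `z` a linear form vanishing at `z` but not at `p` (when `z ≠ p`)
  let ℓ : (Fin m → K) → MvPolynomial (Fin m) K := fun z =>
    if hz : z ≠ p then X (Function.ne_iff.1 hz).choose - C (z (Function.ne_iff.1 hz).choose) else 1
  have hℓp : ∀ z, eval p (ℓ z) ≠ 0 := by
    intro z
    by_cases hz : z ≠ p
    · simp only [ℓ, dif_pos hz, map_sub, eval_X, eval_C]
      exact sub_ne_zero.2 (Function.ne_iff.1 hz).choose_spec.symm
    · simp only [ℓ, dif_neg hz, map_one]
      exact one_ne_zero
  have hℓz : ∀ z, z ≠ p → eval z (ℓ z) = 0 := by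
    intro z hz
    simp only [ℓ, dif_pos hz, map_sub, eval_X, eval_C, sub_self]
  obtain ⟨D, hD⟩ := EtaleDatum.exists_image_eq_setOf_eval_ne_zero (∏ z ∈ hZ.toFinset, ℓ z)
  refine ⟨D, ?_, fun z hz hzD => ?_⟩
  · rw [hD, Set.mem_setOf_eq, map_prod]
    exact Finset.prod_ne_zero_iff.2 fun z _ => hℓp z
  · by_contra hne
    rw [hD, Set.mem_setOf_eq, map_prod] at hzD
    exact hzD (Finset.prod_eq_zero (hZ.mem_toFinset.2 hz) (hℓz z hne))

/-- **A nonempty étale-open subset of a set without étale-isolated points is infinite.**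
(If it were finite, a principal open would isolate one of its points.) [folklore] -/
theorem infinite_of_isEtaleOpenIn {V X : Set (Fin m → K)} (hiso : ∀ p, ¬ IsEtaleIsolatedIn K V p)
    (hX : IsEtaleOpenIn K V X) (hne : X.Nonempty) : X.Infinite := by
  intro hfin
  obtain ⟨p, hp⟩ := hne
  obtain ⟨D₁, hpD₁, hD₁⟩ := exists_etaleDatum_isolating hfin p
  refine hiso p (isEtaleIsolatedIn_of_isEtaleOpenIn hX hp D₁ ?_ ?_)
  · rintro x ⟨hxD, hxX⟩
    exact Set.mem_singleton_iff.2 (hD₁ x hxX hxD)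
  · intro r₂ D₂ hpD₂
    obtain ⟨D, hD⟩ := D₁.exists_image_eq_inter D₂
    exact ⟨_, D, by rw [hD]; exact ⟨hpD₁, hpD₂⟩, by rw [hD]⟩

end Finite

/-! ### Dimension of loci and of their étale-open subsets over pseudo-finite fields -/

section Psf

variable (K : Type) [Field K] [CompatibleRing K] [Infinite K]

/-- **The projection of a nonempty étale-open subset of a positive-dimensional locus to a free
coordinate is infinite** (pseudo-finite `K`, [JohnsonTranWalsbergYe2024, Thm 7.1]): by induction
on the number of free coordinates, down to a curve, whose étale-open subsets are infinite with
finite coordinate fibres. [folklore] -/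
theorem infinite_image_apply_zero (h71 : JohnsonTranWalsbergYe2024_thm71_psf)
    (hK : K ⊨ finiteFieldTheory) :
    ∀ (d : ℕ) {n c : ℕ} (S : SmoothDatum K (n + 1) c), n = c + d →
      (0 : Fin (n + 1)) ∉ Set.range S.cols →
      ∀ {X : Set (Fin (n + 1) → K)}, IsEtaleOpenIn K S.locus X → X.Nonempty →
        ((fun x => x 0) '' X).Infinite
  | 0, n, c, S, hn, h0, X, hX, hne => by
    -- a curve: `X` is infinite and the fibres of `x ↦ x 0` on the locus are finite
    have hXinf : X.Infinite :=
      infinite_of_isEtaleOpenIn (h71 K hK (n + 1) c (by omega) S) hX hne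
    intro himg
    apply hXinf
    have hcov : X ⊆ ⋃ b ∈ (fun x => x 0) '' X, (S.sliceAt 0 h0 b).locus := fun x hx =>
      Set.mem_biUnion ⟨x, hx, rfl⟩ (by rw [SmoothDatum.locus_sliceAt]; exact ⟨hX.1 hx, rfl⟩)
    exact (himg.biUnion fun b _ => (S.sliceAt 0 h0 b).locus_finite_of_eq (by omega)).subset hcov
  | d + 1, n, c, S, hn, h0, X, hX, ⟨a₀, ha₀⟩ => by
    -- slice at another free coordinate `j ≠ 0` through `a₀` and use the induction hypothesis
    obtain ⟨j, hj, hj0⟩ := S.exists_not_mem_range_cols_ne (by omega) 0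
    have h0' : (0 : Fin (n + 1)) ∉ Set.range (S.sliceAt j hj (a₀ j)).cols := by
      rw [SmoothDatum.range_sliceAt_cols]
      rintro (h | h)
      · exact hj0 h.symm
      · exact h0 h
    have hX₁ : IsEtaleOpenIn K (S.sliceAt j hj (a₀ j)).locus {x | x ∈ X ∧ x j = a₀ j} := by
      rw [SmoothDatum.locus_sliceAt]
      exact hX.sep_apply_eq j (a₀ j)
    have := infinite_image_apply_zero h71 hK d (S.sliceAt j hj (a₀ j)) (by omega) h0' hX₁
      ⟨a₀, ha₀, rfl⟩
    exact this.mono (Set.image_mono fun x hx => hx.1)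

/-- **A standard smooth locus of codimension `c` in `K^m` has dimension `< m − c + 1`** over a
pseudo-finite field (conditional on the CDM Main Theorem): induction on `d = m − c` — a locus
of codimension `m` is finite; in general, after a coordinate permutation a free coordinate is
the first one, every slice `{x ∈ V | x 0 = b}` is a locus of codimension `c + 1`, and the
dimension of the definable set `V` is permutation invariant. [folklore]
[cite: ChatzidakisVanDenDriesMacintyre1992, Main Theorem and §3] -/
theorem SmoothDatum.not_dimAtLeast_locus (hCDM : ChatzidakisVanDenDriesMacintyre1992_mainTheorem)
    (hK : K ⊨ finiteFieldTheory) :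
    ∀ (d : ℕ) {m c : ℕ} (S : SmoothDatum K m c), m = c + d → ¬ DimAtLeast m S.locus (d + 1)
  | 0, m, c, S, hm => not_dimAtLeast_one_of_finite (S.locus_finite_of_eq (by omega))
  | d + 1, m, c, S, hm => by
    obtain ⟨n, rfl⟩ : ∃ n, m = n + 1 := ⟨c + d, by omega⟩
    obtain ⟨j, hj⟩ := S.exists_not_mem_range_cols (by omega)
    -- move the free coordinate `j` to position `0`
    have h0 : (0 : Fin (n + 1)) ∉ Set.range (S.perm (Equiv.swap j 0)).cols := by
      rintro ⟨k, hk⟩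
      rw [SmoothDatum.perm_cols] at hk
      exact hj ⟨k, (Equiv.swap j 0).injective (hk.trans (Equiv.swap_apply_left j 0).symm)⟩
    have hslice : ∀ b, ¬ DimAtLeast (n + 1) (slice (S.perm (Equiv.swap j 0)).locus b) (d + 1) := by
      intro b
      have := SmoothDatum.not_dimAtLeast_locus hCDM hK d ((S.perm (Equiv.swap j 0)).sliceAt 0 h0 b)
        (by omega)
      rwa [SmoothDatum.locus_sliceAt] at this
    have hS' := not_dimAtLeast_succ_of_forall_slice _ _ hslice
    -- transport back along the permutation (the locus is definable)
    obtain ⟨γ, _, φ, v, hφ⟩ := S.exists_defSet_eq_locus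
    rw [SmoothDatum.locus_perm, ← hφ, dimAtLeast_preimage_perm_iff hCDM K hK φ _ v] at hS'
    rwa [← hφ]

/-- **A definable set containing a nonempty étale-open subset of a standard smooth locus of
codimension `c` has dimension `≥ m − c`** over a pseudo-finite field (conditional on CDM and on
[JohnsonTranWalsbergYe2024, Thm 7.1]): induction on `d = m − c` — permute a free coordinate to
position `0`; infinitely many slices `x 0 = b` meet the open set (`infinite_image_apply_zero`),
each slice of the definable set contains a nonempty étale-open subset of the slice locus
(codimension `c + 1`), so has dimension `≥ d − 1` by induction; conclude by the lower slicing
rule and permutation invariance. [folklore]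
[cite: JohnsonTranWalsbergYe2024, Thm 7.1] [cite: ChatzidakisVanDenDriesMacintyre1992, Main Theorem and §3] -/
theorem SmoothDatum.dimAtLeast_of_isEtaleOpenIn
    (hCDM : ChatzidakisVanDenDriesMacintyre1992_mainTheorem)
    (h71 : JohnsonTranWalsbergYe2024_thm71_psf) (hK : K ⊨ finiteFieldTheory) :
    ∀ (d : ℕ) {m c : ℕ} (S : SmoothDatum K m c), m = c + d →
      ∀ {X' : Set (Fin m → K)}, IsEtaleOpenIn K S.locus X' → X'.Nonempty →
        ∀ {γ : Type} [Finite γ] (φ : Language.ring.Formula (Fin m ⊕ γ)) (v : γ → K),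
          X' ⊆ defSet φ K v → DimAtLeast m (defSet φ K v) d
  | 0, m, c, S, hm, X', hX', hne, γ, _, φ, v, hsub => (dimAtLeast_zero_iff _).2 (hne.mono hsub)
  | d + 1, m, c, S, hm, X', hX', hne, γ, hγ, φ, v, hsub => by
    obtain ⟨n, rfl⟩ : ∃ n, m = n + 1 := ⟨c + d, by omega⟩
    obtain ⟨j, hj⟩ := S.exists_not_mem_range_cols (by omega)
    set σ : Equiv.Perm (Fin (n + 1)) := Equiv.swap j 0 with hσ
    -- the permuted data
    have h0 : (0 : Fin (n + 1)) ∉ Set.range (S.perm σ).cols := by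
      rintro ⟨k, hk⟩
      rw [SmoothDatum.perm_cols] at hk
      exact hj ⟨k, σ.injective (hk.trans (Equiv.swap_apply_left j 0).symm)⟩
    have hX'' : IsEtaleOpenIn K (S.perm σ).locus {x | x ∘ σ ∈ X'} := by
      rw [SmoothDatum.locus_perm]
      exact hX'.comp_perm σ
    have hne'' : {x | x ∘ σ ∈ X'}.Nonempty := (setOf_comp_perm_mem_nonempty_iff X' σ).2 hne
    have hsub'' : {x | x ∘ σ ∈ X'} ⊆ defSet (φ.relabel (Sum.map σ id)) K v := by
      rw [defSet_relabel_perm]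
      exact fun x hx => hsub hx
    -- it suffices to treat the permuted definable set
    rw [← dimAtLeast_preimage_perm_iff hCDM K hK φ σ v, ← defSet_relabel_perm]
    obtain ⟨ψ, hψ⟩ := exists_formula_slice (φ.relabel (Sum.map σ id))
    refine dimAtLeast_succ_of_infinite_slices _ d ?_
    refine (infinite_image_apply_zero K h71 hK d (S.perm σ) (by omega) h0 hX'' hne'').mono ?_
    rintro b ⟨x, hx, rfl⟩
    show DimAtLeast (n + 1) (slice (defSet (φ.relabel (Sum.map σ id)) K v) (x 0)) d
    rw [← hψ K v (x 0)]
    refine SmoothDatum.dimAtLeast_of_isEtaleOpenIn hCDM h71 hK d ((S.perm σ).sliceAt 0 h0 (x 0))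
      (by omega) (X' := {y | y ∈ {x | x ∘ σ ∈ X'} ∧ y 0 = x 0}) ?_ ⟨x, hx, rfl⟩ ψ _ ?_
    · rw [SmoothDatum.locus_sliceAt]
      exact hX''.sep_apply_eq 0 (x 0)
    · rw [hψ K v (x 0)]
      rintro y ⟨hy, hy0⟩
      exact ⟨hsub'' hy, hy0⟩

end Psf

end Literature.ModelTheory.PseudofiniteFields
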